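import Literature.Analysis.FluidPDE.NSLocalClassical
import Literature.Analysis.FluidPDE.NSLocalRegular
import Literature.Analysis.FluidPDE.LerayHopfProofs
import HarnessLib

/-!
# Discharge of `local_classical_lerayHopf`

`Literature.Analysis.FluidPDE.NSLocalClassical` records the named fact
`Literature.Analysis.FluidPDE.local_classical_lerayHopf`: for `ν > 0` and a smooth, divergence-free, rapidly
decaying datum on `ℝ³` there are `T > 0` and a classical solution `(u, p)` on `ℝ³ × [0, T)` with
`u 0 = u₀` that is a Leray–Hopf weak solution on `[0, T]`.

This file proves it (`local_classical_lerayHopf_holds`) from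

* the existence theorem `Literature.Analysis.FluidPDE.local_regular_solution_exists` (`NSLocalRegular`: Leray's local
  regular solution for Schwartz data, constructed by a Fourier-side Picard iteration in the files
  `NSFourier*` — a classical solution on the closed slab `[0, T] × ℝ³` with `u ∈ C([0,T]; L²)`,
  `∇u ∈ L²ₜₓ`, `u ∈ L³ₜₓ`, `p u ∈ L¹ₜₓ`; Leray 1934, §19), and
* the tree's proved `Literature.Analysis.FluidPDE.IsClassicalNSSolutionOn.isLerayHopfOn_holds` (Leray 1934, §32:
  "toute solution régulière constitue a fortiori une solution turbulente") for the Leray–Hopf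
  clauses, with `IsClassicalNSSolutionOn.mono` (`Ico 0 T ⊆ Icc 0 T`, a set of unique
  differentiability) for the classical clauses.

## References

* J. Leray, *Sur le mouvement d'un liquide visqueux emplissant l'espace*, Acta Math. 63 (1934),
  §19, §32. [Leray1934]
* W. S. Ożański, B. C. Pooley, *Leray's fundamental work on the Navier–Stokes equations: a modern
  review*, LMS Lecture Notes 452, CUP 2018, Thm. 6.22, Cor. 6.16, Lemma 6.21. [OzanskiPooley2018]
-/

noncomputable section

open Set MeasureTheory
open scoped ENNReal

namespace Literature.Analysis.FluidPDE

/-- **Reduction.** A classical solution on the closed slab `[0, T] × ℝ³` with `u ∈ C([0,T]; L²)`,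
`∇u ∈ L²ₜₓ`, `u ∈ L³ₜₓ`, `p u ∈ L¹ₜₓ` is a classical solution on `[0, T)` (restriction,
`IsClassicalNSSolutionOn.mono`, `uniqueDiffOn_Ico`) and a Leray–Hopf weak solution on `[0, T]`
(the proved `IsClassicalNSSolutionOn.isLerayHopfOn_holds`; the force vanishes, so `⟪f, u⟫ ∈ L¹`
trivially) (Leray 1934, §32; Ożański–Pooley 2018, Lemma 6.21). [cite: Leray1934, §32] -/
theorem isLerayHopfOn_of_regular {T ν : ℝ} (hT : 0 < T)
    {u : ℝ → EuclideanSpace ℝ (Fin 3) → EuclideanSpace ℝ (Fin 3)}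
    {p : ℝ → EuclideanSpace ℝ (Fin 3) → ℝ} (hcl : IsClassicalNSSolutionOn (Icc 0 T) ν 0 u p)
    (hC : ContinuousInLpOn (Icc 0 T) 2 u)
    (hgrad : ∫⁻ t in Ioo 0 T, ∫⁻ x, ENNReal.ofReal (frobeniusNormSq (fderiv ℝ (u t) x)) < ∞)
    (hu3 : ∫⁻ t in Ioo 0 T, ∫⁻ x, ‖u t x‖ₑ ^ (3 : ℕ) < ∞)
    (hpu : ∫⁻ t in Ioo 0 T, ∫⁻ x, ‖p t x‖ₑ * ‖u t x‖ₑ < ∞) :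
    IsClassicalNSSolutionOn (Ico 0 T) ν 0 u p ∧ IsLerayHopfOn T ν 0 (u 0) u := by
  refine ⟨hcl.mono Ico_subset_Icc_self (uniqueDiffOn_Ico 0 T), ?_⟩
  have hf : ∫⁻ t in Ioo 0 T, ∫⁻ x, ‖(0 : ℝ → EuclideanSpace ℝ (Fin 3) → EuclideanSpace ℝ (Fin 3))
      t x‖ₑ * ‖u t x‖ₑ < ∞ := by
    simp
  exact IsClassicalNSSolutionOn.isLerayHopfOn_holds (E := EuclideanSpace ℝ (Fin 3))
    (T := T) (ν := ν) (f := 0) (u := u) (p := p) hcl hT Subset.rfl hC hgrad hu3 hpu hf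

/-- **Discharge of `local_classical_lerayHopf`**: for `ν > 0` and Schwartz-class divergence-free
data on `ℝ³` there are `T > 0` and a classical solution `(u, p)` of the Navier–Stokes system on
`ℝ³ × [0, T)` with `u 0 = u₀` which is a Leray–Hopf weak solution on `[0, T]` — Leray's local
regular solution (`local_regular_solution_exists`, Leray 1934, §19) is a fortiori a *solution
turbulente* (Leray 1934, §32). [cite: Leray1934, §19 and §32] -/
theorem local_classical_lerayHopf_holds : local_classical_lerayHopf := by
  intro ν hν u₀ hu₀ hdiv hdec
  obtain ⟨T, hT, u, p, hcl, h0, hC, hgrad, hu3, hpu⟩ :=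
    local_regular_solution_exists ν hν u₀ hu₀ hdiv hdec
  obtain ⟨hcl', hLH⟩ := isLerayHopfOn_of_regular hT hcl hC hgrad hu3 hpu
  refine ⟨T, hT, u, p, hcl', h0, ?_⟩
  rwa [h0] at hLH

end Literature.Analysis.FluidPDE

end
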